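import Summits.HubbardSuperconductivity.HubbardSuperconductivity.Theorems.WidthHaldaneDefs
import Literature.MathematicalPhysics.QuantumLattice.FermionHopAmplitudeBound
import Literature.MathematicalPhysics.QuantumLattice.HubbardGaugeBound

/-!
# Kinematic bounds on the column `d_{x²-y²}` pair correlator of the Hubbard tubes

Crux `WidthHaldaneBridge` (stmt-HubbardSuperconductivity-16311; routes `WidthHaldane`, `SeamInduction`)
reads the column pair correlator `G_ψ(r) = tubeColumnPairCorr L M Λ e ψ r = Σ_a Re⟨Φ_a ψ, Φ_{a+r} ψ⟩`,
`Φ_a = Σ_b P_{e⁻¹(a,b)}` (`Theorems/WidthHaldaneDefs.lean`). This file proves the KINEMATIC facts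
about `G_ψ` — valid for every Fock vector `ψ`, no spectral input — on which the exactness of the
registered line `column_factorisation` rests (`Theorems/WidthHaldaneColumnFactorisationExact.lean`):

* `two_mul_re_star_dotProduct_le` — `2·Re⟨u, v⟩ ≤ ‖u‖² + ‖v‖²` (Cauchy–Schwarz + AM–GM);
* `sum_re_star_dotProduct_shift_le` — for any family `v : ℤ/L → (n → ℂ)` and shift `r`,
  `Σ_a Re⟨v_a, v_{a+r}⟩ ≤ Σ_a ‖v_a‖²` (reindex the second square by `a ↦ a + r`);
* `tubeColumnPairCorr_le_zero` — **`G_ψ(r) ≤ G_ψ(0)`** for every `ψ` and every `r`;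
  `tubeColumnPairCorr_zero_nonneg` — `0 ≤ G_ψ(0) = Σ_a ‖Φ_a ψ‖²`;
* `eucNorm_annihilation_mul_annihilation_mulVec_le` — `‖c_p c_q v‖ ≤ ‖v‖` (the `c_p` are
  contractions, `Literature…norm_annihilation_le_one`); `eucNorm_tubeDWavePair_mulVec_le`
  (`‖P_x v‖ ≤ 4√2‖v‖`), `eucNorm_columnPair_mulVec_le` (`‖Φ_a v‖ ≤ 4√2·M‖v‖`) and the
  **kinematic ceiling** `tubeColumnPairCorr_zero_le`: `G_ψ(0) ≤ 32·L·M²` for unit `ψ` — the crux's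
  amplitude normalisation `A·L·M²` is the maximal possible scaling of `G_ψ(0)` (transverse pair
  coherence across the whole circumference).

Sources for the objects only: Scalapino, Phys. Rep. 250 (1995) 329, §2 (column `d_{x²-y²}` pair
field); Bratteli–Robinson, *Operator Algebras and QSM 2*, Prop. 5.2.2 (CAR, `‖a(f)‖ = ‖f‖`).
-/

noncomputable section

namespace Summit.HubbardSuperconductivity.HubbardSuperconductivity.Theorems.WidthHaldane

set_option linter.dupNamespace false -- summit = problem name (single-conjunct summit), D-0017

open scoped BigOperators Classical Matrix ComplexConjugate
open Matrix Literature.MathematicalPhysics.QuantumLattice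

/-! ### Cauchy–Schwarz bookkeeping on `n → ℂ` -/

section Kinematics

variable {n : Type*} [Fintype n]

/-- `2·Re⟨u, v⟩ ≤ ‖u‖² + ‖v‖²` for the standard Hermitian form `⟨u, v⟩ = star u ⬝ᵥ v`
(Cauchy–Schwarz followed by `2ab ≤ a² + b²`). [folklore] -/
theorem two_mul_re_star_dotProduct_le (u v : n → ℂ) :
    2 * (star u ⬝ᵥ v).re ≤ (star u ⬝ᵥ u).re + (star v ⬝ᵥ v).re := by
  have h1 : (star u ⬝ᵥ v).re ≤ eucNorm u * eucNorm v :=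
    (Complex.re_le_norm _).trans (norm_star_dotProduct_le u v)
  rw [← eucNorm_sq u, ← eucNorm_sq v]
  nlinarith [sq_nonneg (eucNorm u - eucNorm v)]

/-- **Shifted overlaps are dominated by the squares.** For a family of vectors `v : ℤ/L → (n → ℂ)`
and any shift `r`, `Σ_a Re⟨v_a, v_{a+r}⟩ ≤ Σ_a ‖v_a‖²`: bound each term by
`(‖v_a‖² + ‖v_{a+r}‖²)/2` and reindex the second sum by the bijection `a ↦ a + r`. [folklore] -/
theorem sum_re_star_dotProduct_shift_le {L : ℕ} [NeZero L] (v : ZMod L → n → ℂ) (r : ZMod L) :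
    ∑ a : ZMod L, (star (v a) ⬝ᵥ v (a + r)).re ≤ ∑ a : ZMod L, (star (v a) ⬝ᵥ v a).re := by
  have hterm : ∀ a : ZMod L, (star (v a) ⬝ᵥ v (a + r)).re ≤
      ((star (v a) ⬝ᵥ v a).re + (star (v (a + r)) ⬝ᵥ v (a + r)).re) / 2 := by
    intro a
    have := two_mul_re_star_dotProduct_le (v a) (v (a + r))
    linarith
  have hshift : ∑ a : ZMod L, (star (v (a + r)) ⬝ᵥ v (a + r)).re =
      ∑ a : ZMod L, (star (v a) ⬝ᵥ v a).re :=
    Fintype.sum_equiv (Equiv.addRight r) _ _ (fun a => rfl)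
  calc ∑ a : ZMod L, (star (v a) ⬝ᵥ v (a + r)).re
      ≤ ∑ a : ZMod L, ((star (v a) ⬝ᵥ v a).re + (star (v (a + r)) ⬝ᵥ v (a + r)).re) / 2 :=
        Finset.sum_le_sum fun a _ => hterm a
    _ = (∑ a : ZMod L, (star (v a) ⬝ᵥ v a).re +
          ∑ a : ZMod L, (star (v (a + r)) ⬝ᵥ v (a + r)).re) / 2 := by
        rw [← Finset.sum_add_distrib, Finset.sum_div]
    _ = ∑ a : ZMod L, (star (v a) ⬝ᵥ v a).re := by rw [hshift]; ring

end Kinematics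

/-! ### `G_ψ(r) ≤ G_ψ(0)` and `0 ≤ G_ψ(0)` -/

/-- The column correlator as a sum of overlaps of the column pair vectors
`v_a = Φ_a ψ = (Σ_b P_{e⁻¹(a,b)}) ψ`: `G_ψ(r) = Σ_a Re⟨v_a, v_{a+r}⟩`. [folklore] -/
theorem tubeColumnPairCorr_eq_sum_dotProduct (L M : ℕ) [NeZero L] [NeZero M] (Λ : Type)
    [LinearOrder Λ] [Fintype Λ] (e : Λ ≃ ZMod L × ZMod M) (ψ : Fock (Orb Λ)) (r : ZMod L) :
    tubeColumnPairCorr L M Λ e ψ r =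
      ∑ a : ZMod L, (star ((∑ b : ZMod M, tubeDWavePair L M Λ e (e.symm (a, b))) *ᵥ ψ) ⬝ᵥ
        ((∑ b : ZMod M, tubeDWavePair L M Λ e (e.symm (a + r, b))) *ᵥ ψ)).re := by
  simp only [tubeColumnPairCorr, PosSemidefTrace.expect_conjTranspose_mul]

/-- **`G_ψ(r) ≤ G_ψ(0)`** for every Fock vector `ψ` of every labelled tube and every long-cycle
displacement `r` (Cauchy–Schwarz, AM–GM, reindexing `a ↦ a + r`). This is the inequality by which
factor T of line `column_factorisation` is a CONSEQUENCE of the crux, and by which a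
`SelectionFailure` point refutes it. [folklore] -/
theorem tubeColumnPairCorr_le_zero (L M : ℕ) [NeZero L] [NeZero M] (Λ : Type) [LinearOrder Λ]
    [Fintype Λ] (e : Λ ≃ ZMod L × ZMod M) (ψ : Fock (Orb Λ)) (r : ZMod L) :
    tubeColumnPairCorr L M Λ e ψ r ≤ tubeColumnPairCorr L M Λ e ψ 0 := by
  rw [tubeColumnPairCorr_eq_sum_dotProduct, tubeColumnPairCorr_eq_sum_dotProduct]
  simp only [add_zero]
  exact sum_re_star_dotProduct_shift_le
    (fun a => (∑ b : ZMod M, tubeDWavePair L M Λ e (e.symm (a, b))) *ᵥ ψ) r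

/-- **`G_ψ(r) ≤ G_ψ(0)`, closed form** (all binders universally quantified; the registered
sub-goal `columnCorr_le_zero` of crux stmt-HubbardSuperconductivity-16311, line
`column_factorisation`). [folklore] -/
theorem columnCorr_le_zero : ∀ (L M : ℕ) [NeZero L] [NeZero M] (Λ : Type) [LinearOrder Λ] [Fintype Λ] (e : Λ ≃ ZMod L × ZMod M) (ψ : Fock (Orb Λ)) (r : ZMod L), tubeColumnPairCorr L M Λ e ψ r ≤ tubeColumnPairCorr L M Λ e ψ 0 :=
  fun L M _ _ Λ _ _ e ψ r => tubeColumnPairCorr_le_zero L M Λ e ψ r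

/-- `G_ψ(0) = Σ_a ‖Φ_a ψ‖² ≥ 0`. [folklore] -/
theorem tubeColumnPairCorr_zero_nonneg (L M : ℕ) [NeZero L] [NeZero M] (Λ : Type) [LinearOrder Λ]
    [Fintype Λ] (e : Λ ≃ ZMod L × ZMod M) (ψ : Fock (Orb Λ)) :
    0 ≤ tubeColumnPairCorr L M Λ e ψ 0 := by
  rw [tubeColumnPairCorr_eq_sum_dotProduct]
  refine Finset.sum_nonneg fun a _ => ?_
  simp only [add_zero]
  rw [← eucNorm_sq]
  positivity

/-! ### The kinematic ceiling `G_ψ(0) ≤ 32·L·M²` -/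

section Ceiling

variable {ι : Type*} [LinearOrder ι] [Fintype ι]

/-- `‖c_p c_q v‖ ≤ ‖v‖`: the annihilation matrices are contractions (`‖c_p‖ ≤ 1`,
`Literature…norm_annihilation_le_one`, Bratteli–Robinson II Prop. 5.2.2). [folklore] -/
theorem eucNorm_annihilation_mul_annihilation_mulVec_le (p q : ι) (v : Fock ι) :
    eucNorm ((annihilation p * annihilation q) *ᵥ v) ≤ eucNorm v := by
  have hc : ∀ (i : ι) (w : Fock ι), eucNorm (annihilation i *ᵥ w) ≤ eucNorm w := by
    intro i w
    refine (eucNorm_mulVec_le _ _).trans ?_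
    have h := norm_annihilation_le_one (ι := ι) i
    have h0 := eucNorm_nonneg w
    nlinarith
  rw [← mulVec_mulVec]
  exact (hc p _).trans (hc q v)

omit [LinearOrder ι] in
/-- The Euclidean norm of the zero vector vanishes. [folklore] -/
theorem eucNorm_zero : eucNorm (0 : Fock ι) = 0 := by
  simp [eucNorm]

omit [LinearOrder ι] in
/-- Triangle inequality for finite sums in the Euclidean norm. [folklore] -/
theorem eucNorm_sum_le {κ : Type*} (s : Finset κ) (f : κ → Fock ι) :
    eucNorm (∑ k ∈ s, f k) ≤ ∑ k ∈ s, eucNorm (f k) := by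
  induction s using Finset.induction_on with
  | empty => simp only [Finset.sum_empty, eucNorm_zero, le_refl]
  | insert k s hk ih =>
    rw [Finset.sum_insert hk, Finset.sum_insert hk]
    exact (eucNorm_add_le _ _).trans (add_le_add le_rfl ih)

/-- An elementary singlet-pair term is bounded by twice its weight:
`‖(c • (c_p c_q - c_{p'} c_{q'})) v‖ ≤ ‖c‖·(‖v‖ + ‖v‖)`. [folklore] -/
theorem eucNorm_smul_pairDiff_mulVec_le (c : ℂ) (p q p' q' : ι) (v : Fock ι) :
    eucNorm ((c • (annihilation p * annihilation q - annihilation p' * annihilation q')) *ᵥ v) ≤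
      ‖c‖ * (eucNorm v + eucNorm v) := by
  rw [smul_mulVec, eucNorm_smul, sub_mulVec]
  exact mul_le_mul_of_nonneg_left ((eucNorm_sub_le _ _).trans (add_le_add
    (eucNorm_annihilation_mul_annihilation_mulVec_le p q v)
    (eucNorm_annihilation_mul_annihilation_mulVec_le p' q' v))) (norm_nonneg c)

end Ceiling

/-- The `d_{x²-y²}` weights `(±1)/√2` have modulus `1/√2`. [folklore] -/
theorem norm_dWaveWeight (j : Fin 4) :
    ‖((((![1, 1, -1, -1] : Fin 4 → ℝ) j / Real.sqrt 2 : ℝ) : ℂ))‖ = 1 / Real.sqrt 2 := by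
  rw [Complex.norm_real, Real.norm_eq_abs, abs_div, abs_of_pos (Real.sqrt_pos.mpr two_pos)]
  congr 1
  fin_cases j <;> simp

/-- `(1/√2)·(e + e) = √2·e`. [folklore] -/
theorem one_div_sqrt_two_mul_two_mul (t : ℝ) :
    1 / Real.sqrt 2 * (t + t) = Real.sqrt 2 * t := by
  have hs : Real.sqrt 2 ≠ 0 := (Real.sqrt_pos.mpr two_pos).ne'
  have hs2 : Real.sqrt 2 * Real.sqrt 2 = 2 := Real.mul_self_sqrt two_pos.le
  have h2 : (2 : ℝ) / Real.sqrt 2 = Real.sqrt 2 := (div_eq_iff hs).mpr hs2.symm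
  calc 1 / Real.sqrt 2 * (t + t) = 2 / Real.sqrt 2 * t := by ring
    _ = Real.sqrt 2 * t := by rw [h2]

/-- **One `d_{x²-y²}` pair annihilator is bounded by `4√2`** on every Fock vector:
`‖P_x v‖ ≤ 4·√2·‖v‖` (four bonds, weight `|±1|/√2`, two spin orderings, each `c c` a contraction).
[folklore] -/
theorem eucNorm_tubeDWavePair_mulVec_le (L M : ℕ) (Λ : Type) [LinearOrder Λ] [Fintype Λ]
    (e : Λ ≃ ZMod L × ZMod M) (x : Λ) (v : Fock (Orb Λ)) :
    eucNorm (tubeDWavePair L M Λ e x *ᵥ v) ≤ 4 * Real.sqrt 2 * eucNorm v := by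
  unfold tubeDWavePair
  rw [sum_mulVec]
  refine (eucNorm_sum_le _ _).trans ?_
  calc ∑ j : Fin 4, _ ≤ ∑ _j : Fin 4, 1 / Real.sqrt 2 * (eucNorm v + eucNorm v) :=
        Finset.sum_le_sum fun j _ => by
          rw [← norm_dWaveWeight j]
          exact eucNorm_smul_pairDiff_mulVec_le _ _ _ _ _ v
    _ = 4 * Real.sqrt 2 * eucNorm v := by
        rw [Finset.sum_const, Finset.card_univ, Fintype.card_fin, one_div_sqrt_two_mul_two_mul,
          nsmul_eq_mul]
        push_cast
        ring

/-- **The column pair field is bounded by `4√2·M`**: `‖Φ_a v‖ ≤ 4·√2·M·‖v‖`. [folklore] -/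
theorem eucNorm_columnPair_mulVec_le (L M : ℕ) [NeZero M] (Λ : Type) [LinearOrder Λ] [Fintype Λ]
    (e : Λ ≃ ZMod L × ZMod M) (a : ZMod L) (v : Fock (Orb Λ)) :
    eucNorm ((∑ b : ZMod M, tubeDWavePair L M Λ e (e.symm (a, b))) *ᵥ v) ≤
      4 * Real.sqrt 2 * (M : ℝ) * eucNorm v := by
  rw [sum_mulVec]
  refine (eucNorm_sum_le _ _).trans ?_
  calc ∑ b : ZMod M, eucNorm (tubeDWavePair L M Λ e (e.symm (a, b)) *ᵥ v)
      ≤ ∑ _b : ZMod M, 4 * Real.sqrt 2 * eucNorm v :=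
        Finset.sum_le_sum fun b _ => eucNorm_tubeDWavePair_mulVec_le L M Λ e _ v
    _ = 4 * Real.sqrt 2 * (M : ℝ) * eucNorm v := by
        rw [Finset.sum_const, Finset.card_univ, ZMod.card]; simp; ring

/-- **Kinematic ceiling**: for a unit vector, `G_ψ(0) = Σ_a ‖Φ_a ψ‖² ≤ 32·L·M²`. Hence the
crux's amplitude normalisation `A·L·M²` is the MAXIMAL possible scaling of `G_ψ(0)` (transverse
pair coherence across the whole circumference), and factor L of line `column_factorisation` is a
consequence of the crux. [folklore] -/
theorem tubeColumnPairCorr_zero_le (L M : ℕ) [NeZero L] [NeZero M] (Λ : Type) [LinearOrder Λ]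
    [Fintype Λ] (e : Λ ≃ ZMod L × ZMod M) {ψ : Fock (Orb Λ)} (hψ : star ψ ⬝ᵥ ψ = 1) :
    tubeColumnPairCorr L M Λ e ψ 0 ≤ 32 * (L : ℝ) * (M : ℝ) ^ 2 := by
  rw [tubeColumnPairCorr_eq_sum_dotProduct]
  have hone : eucNorm ψ = 1 := eucNorm_eq_one hψ
  have hterm : ∀ a : ZMod L,
      (star ((∑ b : ZMod M, tubeDWavePair L M Λ e (e.symm (a, b))) *ᵥ ψ) ⬝ᵥ
        ((∑ b : ZMod M, tubeDWavePair L M Λ e (e.symm (a + 0, b))) *ᵥ ψ)).re ≤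
          32 * (M : ℝ) ^ 2 := by
    intro a
    simp only [add_zero]
    rw [← eucNorm_sq]
    have h := eucNorm_columnPair_mulVec_le L M Λ e a ψ
    rw [hone, mul_one] at h
    have h0 : 0 ≤ eucNorm ((∑ b : ZMod M, tubeDWavePair L M Λ e (e.symm (a, b))) *ᵥ ψ) :=
      eucNorm_nonneg _
    have hs2 : Real.sqrt 2 ^ 2 = 2 := Real.sq_sqrt two_pos.le
    calc eucNorm ((∑ b : ZMod M, tubeDWavePair L M Λ e (e.symm (a, b))) *ᵥ ψ) ^ 2
        ≤ (4 * Real.sqrt 2 * (M : ℝ)) ^ 2 := pow_le_pow_left₀ h0 h 2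
      _ = 32 * (M : ℝ) ^ 2 := by rw [mul_pow, mul_pow, hs2]; ring
  calc ∑ a : ZMod L, _ ≤ ∑ _a : ZMod L, 32 * (M : ℝ) ^ 2 := Finset.sum_le_sum fun a _ => hterm a
    _ = 32 * (L : ℝ) * (M : ℝ) ^ 2 := by
        rw [Finset.sum_const, Finset.card_univ, ZMod.card]; simp; ring

end Summit.HubbardSuperconductivity.HubbardSuperconductivity.Theorems.WidthHaldane

end
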